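import Summits.AtomisticToContinuum.HydrodynamicLimit.Theorems.JParityClosureParityInBandEosExtension
import Summits.AtomisticToContinuum.HydrodynamicLimit.Theorems.InformationPercolationEngineChaosClosesEulerReadoutEvents
import HarnessLib

/-!
# Kinetic reduction (crux `ChaosClosesEuler`, stmt-AtomisticToContinuum-15141, line `Sketch`,
# stub `stub_kineticReduction`) — helper: the band-extension equation of state, uniformly in `σ`

WHAT. The deterministic BF18 shell `BF18ShellHS` runs with a band extension `(χ, f)` of the hard-sphere equation
of state supplied by `exists_hsEos_band_extension`, whose band edge `η₁` is stated per reduced diameter `σ`. The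
frame of the conclusion `MollifiedCloseTimeAveraged` fixes its packing guard `∃ η₀` BEFORE `σ`; this file records
that the band edge of `exists_hsEos_band_extension` does not depend on `σ` (it is the band edge of the global
virial extension of the analytic germ `F` of `hsExcessFreeEnergy`, the scaling `ρ ↦ ρσ³` being applied afterwards):
`exists_hsEos_band_extension_uniform`. It also records the elementary facts on the cut equation of state
`F_c(η) = f_ex(min η η₁) + f_ex'(η₁)(η − η₁)₊` of the clamped local second law (stmt-13352) used by the reduction:
below the band edge it is `f_ex`, and `f_ex` is continuous on `[0, η₀ᵉ/2]`.

No named fact is invoked.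
-/

noncomputable section

namespace Summit.AtomisticToContinuum.HydrodynamicLimit.Theorems.ChaosClosesEulerReduction

open Set MeasureTheory
open Literature.MathematicalPhysics.KineticTheory

/-- **The hard-sphere law, globally extended off the packing band, with a `σ`-INDEPENDENT band edge.** Under
`HsEosLowDensity` there is ONE band edge `η₁ > 0` such that for every reduced diameter `σ > 0` there are
`χ, f : ℝ → ℝ`, `C²` on `(0,∞)`, with the virial relation `χ ρ = 1 + ρ f'(ρ)`, the stability `(ρχ)' > 0`, `χ`
bounded, and agreeing with the hard-sphere law in the band: `f ρ = hsExcessFreeEnergy (ρσ³)`,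
`χ ρ = hsCompressibility (ρσ³)` for `0 < ρ`, `ρσ³ ≤ η₁` (the proof of `exists_hsEos_band_extension`, with the
band edge chosen before `σ`). [folklore] -/
theorem exists_hsEos_band_extension_uniform
    (h : Summit.AtomisticToContinuum.HydrodynamicLimit.Theses.JParityClosure.HsEosLowDensity) :
    ∃ η₁ : ℝ, 0 < η₁ ∧ ∀ σ : ℝ, 0 < σ → ∃ χ f : ℝ → ℝ,
      ContDiffOn ℝ 2 χ (Ioi 0) ∧ ContDiffOn ℝ 2 f (Ioi 0) ∧
      (∀ ρ, 0 < ρ → χ ρ = 1 + ρ * deriv f ρ) ∧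
      (∀ ρ, 0 < ρ → 0 < χ ρ + ρ * deriv χ ρ) ∧
      (∃ B : ℝ, ∀ ρ, 0 < ρ → |χ ρ| ≤ B) ∧
      (∀ ρ, 0 < ρ → ρ * σ ^ 3 ≤ η₁ →
        f ρ = hsExcessFreeEnergy (ρ * σ ^ 3) ∧ χ ρ = hsCompressibility (ρ * σ ^ 3)) := by
  -- adapted from `exists_hsEos_band_extension` (JParityClosureParityInBandEosExtension): the band edge `η₁` of
  -- `exists_global_virial_extension` is chosen from the germ `F` only, before the scaling by `σ³`
  obtain ⟨η₀, hη₀, F, hFa, hFeq, -, -, -⟩ := h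
  have hF3 : ContDiffOn ℝ 3 F (Ioo (-η₀) η₀) := hFa.contDiffOn isOpen_Ioo.uniqueDiffOn
  obtain ⟨η₁, hη₁, hη₁η₀, χt, Ft, hχtc, hFtc, hvir, hstab, ⟨B, hB⟩, hFband, hχband⟩ :=
    exists_global_virial_extension hη₀ hF3
  refine ⟨η₁, hη₁, fun σ hσ => ?_⟩
  have hσ3 : 0 < σ ^ 3 := by positivity
  have hmaps : MapsTo (fun ρ : ℝ => ρ * σ ^ 3) (Ioi 0) (Ioi 0) := fun ρ hρ => mul_pos hρ hσ3
  have hsc : ContDiff ℝ 2 (fun ρ : ℝ => ρ * σ ^ 3) := contDiff_id.mul contDiff_const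
  have hFtd : ∀ η, 0 < η → HasDerivAt Ft (deriv Ft η) η := fun η hη =>
    ((hFtc.differentiableOn (by norm_num)).differentiableAt (isOpen_Ioi.mem_nhds hη)).hasDerivAt
  have hχtd : ∀ η, 0 < η → HasDerivAt χt (deriv χt η) η := fun η hη =>
    ((hχtc.differentiableOn (by norm_num)).differentiableAt (isOpen_Ioi.mem_nhds hη)).hasDerivAt
  have hdf : ∀ ρ, 0 < ρ → deriv (fun r => Ft (r * σ ^ 3)) ρ = deriv Ft (ρ * σ ^ 3) * σ ^ 3 :=
    fun ρ hρ => ((hFtd _ (mul_pos hρ hσ3)).comp ρ (hasDerivAt_mul_const (σ ^ 3))).deriv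
  have hdχ : ∀ ρ, 0 < ρ → deriv (fun r => χt (r * σ ^ 3)) ρ = deriv χt (ρ * σ ^ 3) * σ ^ 3 :=
    fun ρ hρ => ((hχtd _ (mul_pos hρ hσ3)).comp ρ (hasDerivAt_mul_const (σ ^ 3))).deriv
  refine ⟨fun ρ => χt (ρ * σ ^ 3), fun ρ => Ft (ρ * σ ^ 3),
    hχtc.comp hsc.contDiffOn hmaps, hFtc.comp hsc.contDiffOn hmaps, ?_, ?_, ⟨B, fun ρ hρ =>
      hB _ (mul_pos hρ hσ3)⟩, ?_⟩
  · intro ρ hρ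
    beta_reduce
    rw [hdf ρ hρ, hvir _ (mul_pos hρ hσ3)]
    ring
  · intro ρ hρ
    beta_reduce
    rw [hdχ ρ hρ]
    have := hstab _ (mul_pos hρ hσ3)
    nlinarith [this]
  · intro ρ hρ hband
    have hη : ρ * σ ^ 3 ∈ Ioc 0 η₁ := ⟨mul_pos hρ hσ3, hband⟩
    have hηU : ρ * σ ^ 3 ∈ Ioo (-η₀) η₀ := ⟨by linarith [hη.1], by linarith [hη.2]⟩
    have hev : hsExcessFreeEnergy =ᶠ[nhds (ρ * σ ^ 3)] F := by
      have hIoo : Ioo (0 : ℝ) η₀ ∈ nhds (ρ * σ ^ 3) :=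
        isOpen_Ioo.mem_nhds ⟨hη.1, hηU.2⟩
      exact Filter.eventually_of_mem hIoo fun x hx => hFeq ⟨hx.1.le, hx.2⟩
    refine ⟨?_, ?_⟩
    · beta_reduce
      rw [hFband _ hη]
      exact (hFeq ⟨hη.1.le, hηU.2⟩).symm
    · beta_reduce
      rw [hχband _ hη, hsCompressibility, hev.deriv_eq]

/-- **The band edge may be taken below any prescribed positive level** (shrinking the band keeps every
property). [folklore] -/
theorem exists_hsEos_band_extension_uniform_le
    (h : Summit.AtomisticToContinuum.HydrodynamicLimit.Theses.JParityClosure.HsEosLowDensity)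
    {c : ℝ} (hc : 0 < c) :
    ∃ η₁ : ℝ, 0 < η₁ ∧ η₁ ≤ c ∧ ∀ σ : ℝ, 0 < σ → ∃ χ f : ℝ → ℝ,
      ContDiffOn ℝ 2 χ (Ioi 0) ∧ ContDiffOn ℝ 2 f (Ioi 0) ∧
      (∀ ρ, 0 < ρ → χ ρ = 1 + ρ * deriv f ρ) ∧
      (∀ ρ, 0 < ρ → 0 < χ ρ + ρ * deriv χ ρ) ∧
      (∃ B : ℝ, ∀ ρ, 0 < ρ → |χ ρ| ≤ B) ∧
      (∀ ρ, 0 < ρ → ρ * σ ^ 3 ≤ η₁ →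
        f ρ = hsExcessFreeEnergy (ρ * σ ^ 3) ∧ χ ρ = hsCompressibility (ρ * σ ^ 3)) := by
  obtain ⟨η₁, hη₁, H⟩ := exists_hsEos_band_extension_uniform h
  refine ⟨min η₁ c, lt_min hη₁ hc, min_le_right _ _, fun σ hσ => ?_⟩
  obtain ⟨χ, f, h1, h2, h3, h4, h5, h6⟩ := H σ hσ
  exact ⟨χ, f, h1, h2, h3, h4, h5, fun ρ hρ hb => h6 ρ hρ (hb.trans (min_le_left _ _))⟩

/-- **Registered sub-goal `stub_reductionEos` (helper of `stub_kineticReduction`): the cut equation of state of the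
clamped local second law below its band edge.** For `c ≤ η₁`, `F_c(c) = f_ex(min c η₁) + f_ex'(η₁) (c − η₁)₊ = f_ex(c)`:
on the density-cap event the clamped law (stmt-13352) and the band-extension shell evaluate the same free energy.
[folklore] -/
theorem stub_reductionEos : ∀ {η₁ c : ℝ}, c ≤ η₁ → hsExcessFreeEnergy (min c η₁) + deriv hsExcessFreeEnergy η₁ * max (c - η₁) 0 = hsExcessFreeEnergy c := by
  intro η₁ c hc
  rw [min_eq_left hc, max_eq_right (by linarith), mul_zero, add_zero]

/-- **Continuity of the excess free energy in the low-density band.** From the PROVED `HsEosLowDensity`: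
`f_ex` is continuous on `[0, η₀ᵉ/2]` (it agrees on `[0, η₀ᵉ)` with a function analytic on `(−η₀ᵉ, η₀ᵉ)`).
[folklore] -/
theorem continuousOn_hsExcessFreeEnergy {η₀E : ℝ} (hη₀E : 0 < η₀E) {F : ℝ → ℝ}
    (hFan : AnalyticOnNhd ℝ F (Set.Ioo (-η₀E) η₀E)) (hFeq : Set.EqOn hsExcessFreeEnergy F (Set.Ico 0 η₀E)) :
    ContinuousOn hsExcessFreeEnergy (Set.Icc 0 (η₀E / 2)) := by
  have hsub : Set.Icc 0 (η₀E / 2) ⊆ Set.Ico 0 η₀E := fun a ha => ⟨ha.1, by linarith [ha.2]⟩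
  have hF : ContinuousOn F (Set.Icc 0 (η₀E / 2)) :=
    hFan.continuousOn.mono (hsub.trans (Set.Ico_subset_Ioo_left (by linarith)))
  exact hF.congr fun a ha => hFeq (hsub ha)

/-- **The cut equation of state is continuous on `[0, ∞)`** when the band edge lies in `(0, η₀ᵉ/2]`: below the edge it
is `f_ex` (continuous there), above it is affine, and the two branches agree at the edge. [folklore] -/
theorem continuousOn_cutEos {η₀E : ℝ} (hη₀E : 0 < η₀E) {F : ℝ → ℝ}
    (hFan : AnalyticOnNhd ℝ F (Set.Ioo (-η₀E) η₀E)) (hFeq : Set.EqOn hsExcessFreeEnergy F (Set.Ico 0 η₀E))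
    {η₁ : ℝ} (hη₁ : 0 < η₁) (hη₁E : η₁ ≤ η₀E / 2) :
    ContinuousOn (fun c => hsExcessFreeEnergy (min c η₁) + deriv hsExcessFreeEnergy η₁ * max (c - η₁) 0)
      (Set.Ici 0) := by
  have hfe := continuousOn_hsExcessFreeEnergy hη₀E hFan hFeq
  refine ContinuousOn.add ?_ ((continuous_const.mul ((continuous_id.sub continuous_const).max
    continuous_const)).continuousOn)
  refine hfe.comp (continuous_id.min continuous_const).continuousOn fun c hc => ?_
  exact ⟨le_min hc hη₁.le, (min_le_right _ _).trans hη₁E⟩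

/-- **`f_ex` is bounded on the band** `[0, η₀ᵉ/2]`. [folklore] -/
theorem exists_bound_hsExcessFreeEnergy {η₀E : ℝ} (hη₀E : 0 < η₀E) {F : ℝ → ℝ}
    (hFan : AnalyticOnNhd ℝ F (Set.Ioo (-η₀E) η₀E)) (hFeq : Set.EqOn hsExcessFreeEnergy F (Set.Ico 0 η₀E)) :
    ∃ C : ℝ, 0 ≤ C ∧ ∀ a ∈ Set.Icc 0 (η₀E / 2), |hsExcessFreeEnergy a| ≤ C := by
  obtain ⟨C, hC⟩ := (isCompact_Icc : IsCompact (Set.Icc 0 (η₀E / 2))).exists_bound_of_continuousOn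
    (continuousOn_hsExcessFreeEnergy hη₀E hFan hFeq)
  exact ⟨max C 0, le_max_right _ _, fun a ha => by
    rw [← Real.norm_eq_abs]; exact (hC a ha).trans (le_max_left _ _)⟩

end Summit.AtomisticToContinuum.HydrodynamicLimit.Theorems.ChaosClosesEulerReduction

end
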